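import Literature.Probability.RandomPlanarGeometry.SAWKestenPatterns
import Literature.Probability.RandomPlanarGeometry.HammersleyWelshSharp
import Literature.Probability.RandomPlanarGeometry.SAWBridgeUpperBound
import Literature.Probability.RandomPlanarGeometry.BDGS2012CountBoundsProofs
import Mathlib.Algebra.Order.Chebyshev
import Mathlib.Analysis.Real.Pi.Bounds
import HarnessLib

/-!
# An explicit rate in Kesten's ratio limit theorem from an explicit pattern-density input

Kesten (1963) proved `|c_{N+2}/c_N − μ²| ≤ K N^{-1/3}` for the self-avoiding walk counts `c_N` of `ℤ^d`
with an INEXPLICIT constant `K` (quoted in N. Madras, G. Slade, *The Self-Avoiding Walk* (1993), §7.5 Notes,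
eq. (7.5.1), book p. 255; G. Grimmett, arXiv:2004.03861 §5 Thm 13(a); tree named fact
`Zd.Kesten1963_ratioRate`).  The tree proves the LIMIT `c_{N+2}/c_N → μ²` (Madras–Slade Lemma 7.3.1 and
Theorem 7.3.2, `SAWRatioLimit.lean`, `SAWKestenPatterns.lean`) by a qualitative argument, although the proof of
`Zd.thm732_of_patternBound` constructs Kesten's inequality (7.3.4) with the explicit constant
`D = 4/a³ + 2/a² + 10C + 3C·c₂²` from the pattern-density input
`∀ n ≥ 1, #{ω ∈ SAW_n : #(V,Q)-occurrences < a n} ≤ C c_n / n³`.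

This file (lane pcv-sawmu, item X24 = a-idea-1 ROUTES-G4 R12.1; statements typed by a-idea-1,
`Sketch_G4_X24_KestenRate.lean`, taken verbatim) makes the whole chain quantitative:

* `KestenRate.thm732_explicit` — (7.3.4) with the constant `kestenD d a C` exported, every `N ≥ 1`;
* `KestenRate.upper_dev`, `KestenRate.lower_dev` — the quantitative Lemma 7.3.1 (forward/backward iteration of
  (7.3.3) against an explicit envelope `μ^n ≤ c_n ≤ e^{G(n)} μ^n`);
* `KestenRate.ratioRate_Z2_explicit` — on `ℤ²`, for EVERY `N ≥ 1`,
  `|c_{N+2}/c_N − μ²| ≤ μ·√(12 (D + 16) (G(2N) + 1) / N)` with `G(n) = log(n+1) + π√(2(n+1)/3) + log μ`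
  the sharp Hammersley–Welsh envelope of the tree — i.e. a rate `K(a,C)·N^{-1/4}` with `K` in closed form.

Label: exponent `1/4` (weaker than the printed `1/3`, the price of using only the Hammersley–Welsh envelope as
a-priori input), constant EXPLICIT (printed: inexplicit), conditional on the explicit pattern-density input
(residual crux: explicit `(a, C)` on `ℤ²`).
-/

noncomputable section

open Filter Topology Finset
open scoped BigOperators

namespace Literature.Probability.RandomPlanarGeometry.SAW.Zd

namespace KestenRate

/-- The explicit pattern-density input: VERBATIM the hypothesis `hPT` of `Zd.thm732_of_patternBound` (walks on
`ℤ^{d+2}` with fewer than `a·n` occurrences of `(V,Q)` number `≤ C c_n / n³`, every `n ≥ 1`).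
[cite: MadrasSlade1993, Theorem 7.2.3(a) (pattern theorem, polynomial form used in the proof of Theorem 7.3.2)] -/
def PatternDensityPoly (d : ℕ) (a C : ℝ) : Prop :=
  ∀ n : ℕ, 1 ≤ n →
    ((((saws (d + 2) n).filter fun ω => (vCount n ω : ℝ) < a * n).card : ℝ)) ≤
      C * count (d + 2) n / (n : ℝ) ^ 3

/-- The explicit constant of (7.3.4) built inside `thm732_of_patternBound` (`c₂ = c_2(ℤ^{d+2})`).
[cite: MadrasSlade1993, Theorem 7.3.2, eq. (7.3.4)] -/
def kestenD (d : ℕ) (a C : ℝ) : ℝ :=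
  4 / a ^ 3 + 2 / a ^ 2 + 10 * C + 3 * C * (count (d + 2) 2 : ℝ) ^ 2

/-- The explicit Hammersley–Welsh envelope exponent: `c_n ≤ e^{G(n)} μ^n` with
`G(n) = log(n+1) + π√(2(n+1)/3) + log μ`. [cite: MadrasSlade1993, §3.1, Theorem 3.1.1 (sharp code count)] -/
def hwEnvelope (μ : ℝ) (n : ℕ) : ℝ :=
  Real.log ((n : ℝ) + 1) + Real.pi * Real.sqrt (2 * ((n : ℝ) + 1) / 3) + Real.log μ

/-! ### (7.3.4) with its constant exported -/

/-- **Kesten's inequality (7.3.4) with the explicit constant**: under the pattern-density input, for every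
`N ≥ 1`, `(c_{N+2}/c_N)² − D/N ≤ (c_{N+2}/c_N)(c_{N+4}/c_{N+2})` with `D = kestenD d a C`.  (The proof is the
tree's proof of `thm732_of_patternBound`, verbatim, with the constant kept in the statement.)
[cite: MadrasSlade1993, Theorem 7.3.2, eq. (7.3.4)] -/
theorem thm732_explicit (d : ℕ) {a C : ℝ} (ha : 0 < a) (hPT : PatternDensityPoly d a C)
    {N : ℕ} (hN : 1 ≤ N) :
    ((count (d + 2) (N + 2) : ℝ) / count (d + 2) N) ^ 2 - kestenD d a C / N ≤
      ((count (d + 2) (N + 2) : ℝ) / count (d + 2) N) *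
        ((count (d + 2) (N + 4) : ℝ) / count (d + 2) (N + 2)) := by
  have hcpos : ∀ m, (0 : ℝ) < count (d + 2) m := fun m => by exact_mod_cast one_le_count (d + 2) m
  have hC0 : 0 ≤ C := by
    have h := hPT 1 le_rfl
    rw [Nat.cast_one, one_pow, div_one] at h
    exact nonneg_of_mul_nonneg_left ((Nat.cast_nonneg _).trans h) (hcpos 1)
  obtain ⟨c₂, hc₂⟩ : ∃ c₂ : ℝ, c₂ = count (d + 2) 2 := ⟨_, rfl⟩
  obtain ⟨K, hK⟩ : ∃ K : ℝ, K = 4 / a ^ 3 + 2 / a ^ 2 := ⟨_, rfl⟩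
  have hK0 : 0 ≤ K := by rw [hK]; positivity
  have hDdef : kestenD d a C = K + 10 * C + 3 * C * c₂ ^ 2 := by rw [kestenD, hK, hc₂]
  rw [hDdef]
  have hN0 : (0 : ℝ) < N := by exact_mod_cast hN
  have hN1 : (1 : ℝ) ≤ N := by exact_mod_cast hN
  obtain ⟨cN, hcN_def⟩ : ∃ x : ℝ, x = count (d + 2) N := ⟨_, rfl⟩
  obtain ⟨cN2, hcN2_def⟩ : ∃ x : ℝ, x = count (d + 2) (N + 2) := ⟨_, rfl⟩
  obtain ⟨cN4, hcN4_def⟩ : ∃ x : ℝ, x = count (d + 2) (N + 4) := ⟨_, rfl⟩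
  have hcN : 0 < cN := hcN_def ▸ hcpos N
  have hcN2 : 0 < cN2 := hcN2_def ▸ hcpos (N + 2)
  obtain ⟨A, hA⟩ : ∃ x : ℝ, x = ∑ ω ∈ saws (d + 2) N, (uCount N ω : ℝ) / (vCount N ω + 1) := ⟨_, rfl⟩
  obtain ⟨Cq, hCq⟩ : ∃ x : ℝ,
      x = ∑ ω ∈ saws (d + 2) N, ((uCount N ω : ℝ) / ((vCount N ω : ℝ) + 1)) ^ 2 := ⟨_, rfl⟩
  obtain ⟨B, hB⟩ : ∃ x : ℝ, x = ∑ ω ∈ saws (d + 2) N,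
      (uCount N ω : ℝ) * ((uCount N ω : ℝ) - 1) / (((vCount N ω : ℝ) + 1) * ((vCount N ω : ℝ) + 2)) :=
    ⟨_, rfl⟩
  obtain ⟨W₁, hW₁⟩ : ∃ x : ℕ, x = ((saws (d + 2) (N + 2)).filter fun ω => 1 ≤ vCount (N + 2) ω).card :=
    ⟨_, rfl⟩
  obtain ⟨Z, hZ⟩ : ∃ x : ℕ, x = ((saws (d + 2) (N + 2)).filter fun ω => ¬ 1 ≤ vCount (N + 2) ω).card :=
    ⟨_, rfl⟩
  -- (a) `A = w_{N+2}(≥ 0, ≥ 1)` (7.3.6)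
  have ha' : A = W₁ := by rw [hA, hW₁]; exact sum_ratio_eq_card N
  -- (b) `c_{N+2} = w_{N+2}(≥0,≥1) + #{J = 0}`
  have hb : cN2 = W₁ + Z := by
    have h := Finset.card_filter_add_card_filter_not (s := saws (d + 2) (N + 2))
      (fun ω => 1 ≤ vCount (N + 2) ω)
    rw [card_saws] at h
    rw [hcN2_def, ← h, Nat.cast_add, hW₁, hZ]
  -- (c) `B ≤ c_{N+4}` (7.3.7)
  have hc : B ≤ cN4 := by
    rw [hB, hcN4_def]
    refine (sum_ratio₂_le N).trans ?_
    rw [sum_ratio_eq_card (N + 2)]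
    exact_mod_cast (Finset.card_filter_le _ _).trans (card_saws (d + 2) (N + 4)).le
  -- (d) Schwarz (7.3.8): `A² ≤ c_N · Σ (I/(J+1))²`
  have hd : A ^ 2 ≤ cN * Cq := by
    have h := sq_sum_le_card_mul_sum_sq (s := saws (d + 2) N)
      (f := fun ω => (uCount N ω : ℝ) / ((vCount N ω : ℝ) + 1))
    rw [card_saws] at h
    rw [hA, hcN_def, hCq]
    exact h
  -- (e) the term `Ξ_N`
  have he : Cq - B ≤ cN * ((K + 10 * C) / N) := by
    rw [hCq, hB, hcN_def, hK]
    exact sum_xi_le ha hN (hPT N hN)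
  -- (f) the term `S_N`
  have hf : (Z : ℝ) ≤ C * cN2 / N ^ 3 := by
    rw [hZ, hcN2_def]
    exact card_vCount_zero_le ha hC0 hN (hPT (N + 2) (by omega))
  -- (g) `c_{N+2} ≤ c_N c_2`
  have hg : cN2 ≤ cN * c₂ := by
    rw [hcN2_def, hcN_def, hc₂]; exact_mod_cast count_add_le (d + 2) N 2
  ---- assembling
  have hφ : ((count (d + 2) (N + 2) : ℝ) / count (d + 2) N) *
      ((count (d + 2) (N + 4) : ℝ) / count (d + 2) (N + 2)) = cN4 / cN := by
    rw [← hcN_def, ← hcN2_def, ← hcN4_def]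
    field_simp
  rw [hφ, ← hcN_def, ← hcN2_def]
  have hZ0 : (0 : ℝ) ≤ Z := Nat.cast_nonneg _
  have hW0 : (0 : ℝ) ≤ W₁ := Nat.cast_nonneg _
  have hA_le : A ≤ cN2 := by rw [ha', hb]; linarith
  -- `c_{N+2}² = (A + Z)² ≤ c_N Cq + 3 c_{N+2} Z`
  have h1 : cN2 ^ 2 ≤ cN * Cq + 3 * cN2 * Z := by
    have e : cN2 = A + Z := by rw [hb, ha']
    calc cN2 ^ 2 = A ^ 2 + (2 * A + Z) * Z := by rw [e]; ring
      _ ≤ cN * Cq + (2 * cN2 + cN2) * Z := by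
          have : (2 * A + Z) * Z ≤ (2 * cN2 + cN2) * Z :=
            mul_le_mul_of_nonneg_right (by linarith) hZ0
          linarith
      _ = cN * Cq + 3 * cN2 * Z := by ring
  -- `(c_{N+2}/c_N)² ≤ Cq/c_N + 3 c_{N+2} Z / c_N²`
  have h2 : (cN2 / cN) ^ 2 ≤ Cq / cN + 3 * cN2 * Z / cN ^ 2 := by
    have e : Cq / cN + 3 * cN2 * Z / cN ^ 2 = (cN * Cq + 3 * cN2 * Z) / cN ^ 2 := by
      field_simp
    rw [e, div_pow]
    exact div_le_div_of_nonneg_right h1 (by positivity)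
  -- `B/c_N ≤ c_{N+4}/c_N`
  have h3 : B / cN ≤ cN4 / cN := div_le_div_of_nonneg_right hc hcN.le
  -- `(Cq - B)/c_N ≤ (K + 10C)/N`
  have h4 : Cq / cN - B / cN ≤ (K + 10 * C) / N := by
    rw [← sub_div, div_le_iff₀ hcN]
    linarith
  -- `3 c_{N+2} Z / c_N² ≤ 3 C c₂² / N`
  have h5 : 3 * cN2 * Z / cN ^ 2 ≤ 3 * C * c₂ ^ 2 / N := by
    have s1 : 3 * cN2 * (Z : ℝ) ≤ 3 * cN2 * (C * cN2 / N ^ 3) :=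
      mul_le_mul_of_nonneg_left hf (by positivity)
    have s2 : 3 * cN2 * (C * cN2 / N ^ 3) / cN ^ 2 = 3 * C * (cN2 / cN) ^ 2 / N ^ 3 := by
      field_simp
    have s3 : (cN2 / cN) ^ 2 ≤ c₂ ^ 2 := by
      refine pow_le_pow_left₀ (by positivity) ?_ 2
      rw [div_le_iff₀ hcN]; linarith
    have s4 : 3 * C * (cN2 / cN) ^ 2 / N ^ 3 ≤ 3 * C * c₂ ^ 2 / N ^ 3 :=
      div_le_div_of_nonneg_right (mul_le_mul_of_nonneg_left s3 (by positivity)) (by positivity)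
    have s5 : 3 * C * c₂ ^ 2 / (N : ℝ) ^ 3 ≤ 3 * C * c₂ ^ 2 / N := by
      refine div_le_div_of_nonneg_left (by positivity) hN0 ?_
      calc (N : ℝ) = N ^ 1 := (pow_one _).symm
        _ ≤ N ^ 3 := pow_le_pow_right₀ hN1 (by norm_num)
    calc 3 * cN2 * Z / cN ^ 2 ≤ 3 * cN2 * (C * cN2 / N ^ 3) / cN ^ 2 :=
          div_le_div_of_nonneg_right s1 (by positivity)
      _ = 3 * C * (cN2 / cN) ^ 2 / N ^ 3 := s2
      _ ≤ 3 * C * c₂ ^ 2 / N ^ 3 := s4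
      _ ≤ 3 * C * c₂ ^ 2 / N := s5
  have h6 : (K + 10 * C + 3 * C * c₂ ^ 2) / (N : ℝ) = (K + 10 * C) / N + 3 * C * c₂ ^ 2 / N := by
    ring
  rw [h6]
  linarith


/-! ### The additive inequality (7.3.3) with the explicit constant -/

/-- **(7.3.3), explicit**: `c_{n+2}/c_n − D/n ≤ c_{n+4}/c_{n+2}` for every `n ≥ 1` (from (7.3.4), since
`c_{n+2}/c_n ≥ 1`). [cite: MadrasSlade1993, Lemma 7.3.1, eq. (7.3.3)] -/
theorem kesten733_explicit (d : ℕ) {a C : ℝ} (ha : 0 < a) (hPT : PatternDensityPoly d a C)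
    {n : ℕ} (hn : 1 ≤ n) :
    (count (d + 2) (n + 2) : ℝ) / count (d + 2) n - kestenD d a C / n ≤
      (count (d + 2) (n + 4) : ℝ) / count (d + 2) (n + 2) := by
  have hcpos : ∀ m, (0 : ℝ) < count (d + 2) m := fun m => by exact_mod_cast one_le_count (d + 2) m
  have h := thm732_explicit d ha hPT hn
  set φ := (count (d + 2) (n + 2) : ℝ) / count (d + 2) n with hφ
  set φ' := (count (d + 2) (n + 4) : ℝ) / count (d + 2) (n + 2) with hφ'
  have hφ1 : 1 ≤ φ := by
    rw [hφ, le_div_iff₀ (hcpos n), one_mul]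
    exact_mod_cast count_le_count_add_two (d + 2) n
  have hC0 : 0 ≤ C := by
    have h1 := hPT 1 le_rfl
    rw [Nat.cast_one, one_pow, div_one] at h1
    exact nonneg_of_mul_nonneg_left ((Nat.cast_nonneg _).trans h1) (hcpos 1)
  have hD0 : 0 ≤ kestenD d a C := by unfold kestenD; positivity
  have hn0 : (0 : ℝ) < n := by exact_mod_cast hn
  have hφ0 : 0 < φ := by linarith
  have h1 : φ - kestenD d a C / (n * φ) ≤ φ' := by
    have e : φ - kestenD d a C / (n * φ) = (φ ^ 2 - kestenD d a C / n) / φ := by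
      field_simp
    rw [e, div_le_iff₀ hφ0]
    nlinarith
  have h2 : kestenD d a C / (n * φ) ≤ kestenD d a C / n := by
    rw [mul_comm]
    exact div_le_div_of_nonneg_left hD0 hn0 (by nlinarith)
  linarith

/-! ### Quantitative Lemma 7.3.1 -/

/-- **Upper deviation** (quantitative Lemma 7.3.1): if `φ_N ≥ μ² + u` then forward iteration of (7.3.3)
keeps `φ ≥ μ² + u/2` for `M` steps when `M·B ≤ uN/2`, so `(μ² + u/2)^M μ^N ≤ c_{N+2M} ≤ e^{G(N+2M)} μ^{N+2M}`,
i.e. `M log(1 + u/(2μ²)) ≤ G(N+2M)`. [cite: MadrasSlade1993, Lemma 7.3.1 (proof, quantitative form)] -/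
theorem upper_dev {c : ℕ → ℝ} {μ B u : ℝ} {G : ℕ → ℝ} (hc : ∀ n, 0 < c n) (hμ : 0 < μ)
    (hB : 0 ≤ B) (hK : ∀ n : ℕ, 1 ≤ n → c (n + 2) / c n - B / n ≤ c (n + 4) / c (n + 2))
    (hlo : ∀ n, μ ^ n ≤ c n) (hhi : ∀ n, c n ≤ Real.exp (G n) * μ ^ n)
    {N M : ℕ} (hN : 1 ≤ N) (hu : 0 < u) (hdev : μ ^ 2 + u ≤ c (N + 2) / c N)
    (hM : (M : ℝ) * B ≤ u * N / 2) :
    (M : ℝ) * Real.log (1 + u / (2 * μ ^ 2)) ≤ G (N + 2 * M) := by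
  have hN0 : (0 : ℝ) < N := by exact_mod_cast hN
  set q : ℝ := μ ^ 2 + u / 2 with hq
  have hq0 : 0 ≤ q := by positivity
  have hK' : ∀ n : ℕ, 1 ≤ n → (fun n => c (n + 2) / c n) n - B / n ≤ (fun n => c (n + 2) / c n) (n + 2) := by
    intro n hn; simpa [add_assoc] using hK n hn
  have hiter := kesten_iter_forward (φ := fun n => c (n + 2) / c n) (N₁ := 1) hB hK' hN hN
  -- `φ_{N+2k} ≥ q` for `k < M`
  have hstep : ∀ k < M, q ≤ c (N + 2 * k + 2) / c (N + 2 * k) := by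
    intro k hk
    have h1 := hiter k
    have h2 : (k : ℝ) * B / N ≤ u / 2 := by
      rw [div_le_iff₀ hN0]
      have : (k : ℝ) * B ≤ M * B := mul_le_mul_of_nonneg_right (by exact_mod_cast hk.le) hB
      linarith
    have e : c (N + 2 * k + 2) / c (N + 2 * k) = (fun n => c (n + 2) / c n) (N + 2 * k) := rfl
    rw [e]
    linarith
  have hprod := kesten_prod_ge hc (n := N) (M := M) hq0 hstep
  -- `q^M μ^N ≤ e^{G} μ^{N+2M}`
  have h1 : q ^ M * μ ^ N ≤ Real.exp (G (N + 2 * M)) * μ ^ (N + 2 * M) :=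
    calc q ^ M * μ ^ N ≤ q ^ M * c N := mul_le_mul_of_nonneg_left (hlo N) (pow_nonneg hq0 M)
      _ ≤ c (N + 2 * M) := hprod
      _ ≤ _ := hhi _
  have h2 : (q / μ ^ 2) ^ M ≤ Real.exp (G (N + 2 * M)) := by
    rw [div_pow, div_le_iff₀ (by positivity), ← pow_mul]
    have e : μ ^ (N + 2 * M) = μ ^ (2 * M) * μ ^ N := by rw [pow_add, mul_comm]
    have h1' : q ^ M * μ ^ N ≤ Real.exp (G (N + 2 * M)) * μ ^ (2 * M) * μ ^ N := by
      rw [mul_assoc, ← e]; exact h1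
    exact le_of_mul_le_mul_right h1' (pow_pos hμ N)
  have hr : q / μ ^ 2 = 1 + u / (2 * μ ^ 2) := by rw [hq]; field_simp
  have hr0 : 0 < q / μ ^ 2 := by rw [hr]; positivity
  have h3 := Real.log_le_log (pow_pos hr0 M) h2
  rw [Real.log_exp, Real.log_pow, hr] at h3
  exact h3

/-- **Lower deviation** (quantitative Lemma 7.3.1): write the index as `N' + 2M` with `2M ≤ N'`; if
`φ_{N'+2M} ≤ μ² − u` and `4MB ≤ u(N'+2M)` then backward iteration keeps `φ ≤ μ² − u/2` on `[N', N'+2M]`, so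
`μ^{N'+2M} ≤ c_{N'+2M} ≤ (μ² − u/2)^M c_{N'} ≤ (μ² − u/2)^M e^{G(N')} μ^{N'}`, i.e.
`−M log(1 − u/(2μ²)) ≤ G(N')`. [cite: MadrasSlade1993, Lemma 7.3.1 (proof, quantitative form)] -/
theorem lower_dev {c : ℕ → ℝ} {μ B u : ℝ} {G : ℕ → ℝ} (hc : ∀ n, 0 < c n) (hμ : 0 < μ)
    (hB : 0 ≤ B) (hK : ∀ n : ℕ, 1 ≤ n → c (n + 2) / c n - B / n ≤ c (n + 4) / c (n + 2))
    (hlo : ∀ n, μ ^ n ≤ c n) (hhi : ∀ n, c n ≤ Real.exp (G n) * μ ^ n)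
    {N' M : ℕ} (hN' : 1 ≤ N') (h2M : 2 * M ≤ N') (hu : 0 < u)
    (hdev : c (N' + 2 * M + 2) / c (N' + 2 * M) ≤ μ ^ 2 - u)
    (hM : 4 * (M : ℝ) * B ≤ u * ((N' : ℝ) + 2 * M)) :
    -((M : ℝ) * Real.log (1 - u / (2 * μ ^ 2))) ≤ G N' := by
  have hN0 : (0 : ℝ) < N' := by exact_mod_cast hN'
  have hφpos : 0 < c (N' + 2 * M + 2) / c (N' + 2 * M) := div_pos (hc _) (hc _)
  have huμ : u < μ ^ 2 := by linarith
  set q : ℝ := μ ^ 2 - u / 2 with hq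
  have hq0 : 0 < q := by rw [hq]; linarith
  have hK' : ∀ n : ℕ, 1 ≤ n → (fun n => c (n + 2) / c n) n - B / n ≤ (fun n => c (n + 2) / c n) (n + 2) := by
    intro n hn; simpa [add_assoc] using hK n hn
  have hiter := kesten_iter_backward (φ := fun n => c (n + 2) / c n) (N₁ := 1) hB hK'
  have hMB : (M : ℝ) * B / N' ≤ u / 2 := by
    rw [div_le_iff₀ hN0]
    have : (2 : ℝ) * M ≤ N' := by exact_mod_cast h2M
    nlinarith
  -- `φ_{N'+2j} ≤ q` for `j < M`
  have hstep : ∀ j < M, c (N' + 2 * j + 2) / c (N' + 2 * j) ≤ q := by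
    intro j hj
    have h1 := hiter (M - j) (N' + 2 * j) (by omega) (by omega)
    have e : N' + 2 * j + 2 * (M - j) = N' + 2 * M := by omega
    rw [e] at h1
    have h2 : ((M - j : ℕ) : ℝ) * B / ((N' + 2 * j : ℕ) : ℝ) ≤ M * B / N' := by
      have hMj : ((M - j : ℕ) : ℝ) ≤ M := by exact_mod_cast Nat.sub_le M j
      have hden : (N' : ℝ) ≤ ((N' + 2 * j : ℕ) : ℝ) := by exact_mod_cast Nat.le_add_right N' (2 * j)
      calc ((M - j : ℕ) : ℝ) * B / ((N' + 2 * j : ℕ) : ℝ) ≤ M * B / ((N' + 2 * j : ℕ) : ℝ) :=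
            div_le_div_of_nonneg_right (mul_le_mul_of_nonneg_right hMj hB) (by positivity)
        _ ≤ M * B / N' := div_le_div_of_nonneg_left (by positivity) hN0 hden
    have e1 : c (N' + 2 * j + 2) / c (N' + 2 * j) = (fun n => c (n + 2) / c n) (N' + 2 * j) := rfl
    have e2 : c (N' + 2 * M + 2) / c (N' + 2 * M) = (fun n => c (n + 2) / c n) (N' + 2 * M) := rfl
    rw [e1]; rw [e2] at hdev
    linarith
  have hprod := kesten_prod_le hc (n := N') (M := M) hstep
  -- `μ^{N'+2M} ≤ q^M e^{G N'} μ^{N'}`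
  have h1 : μ ^ (N' + 2 * M) ≤ q ^ M * (Real.exp (G N') * μ ^ N') :=
    calc μ ^ (N' + 2 * M) ≤ c (N' + 2 * M) := hlo _
      _ ≤ q ^ M * c N' := hprod
      _ ≤ q ^ M * (Real.exp (G N') * μ ^ N') := mul_le_mul_of_nonneg_left (hhi N') (pow_nonneg hq0.le M)
  have h2 : (1 : ℝ) ≤ (q / μ ^ 2) ^ M * Real.exp (G N') := by
    rw [div_pow, ← pow_mul]
    have hμpow : 0 < μ ^ (2 * M) := pow_pos hμ _
    rw [div_mul_eq_mul_div, le_div_iff₀ hμpow, one_mul]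
    have e : μ ^ (N' + 2 * M) = μ ^ (2 * M) * μ ^ N' := by rw [pow_add, mul_comm]
    have h1' : μ ^ (2 * M) * μ ^ N' ≤ q ^ M * Real.exp (G N') * μ ^ N' := by
      rw [← e, mul_assoc]; exact h1
    exact le_of_mul_le_mul_right h1' (pow_pos hμ N')
  have hr : q / μ ^ 2 = 1 - u / (2 * μ ^ 2) := by rw [hq]; field_simp
  have hr0 : 0 < q / μ ^ 2 := by positivity
  have h3 := Real.log_le_log one_pos h2
  rw [Real.log_one, Real.log_mul (pow_pos hr0 M).ne' (Real.exp_pos _).ne', Real.log_exp, Real.log_pow,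
    hr] at h3
  linarith

/-! ### The envelope and elementary inequalities -/

/-- The Hammersley–Welsh envelope: `c_n ≤ e^{G(n)} μ^n` with `G = hwEnvelope μ`
(`count_le_sharp_mul_bridgeCount` and `b_{n+1} ≤ μ^{n+1}`). [cite: MadrasSlade1993, §3.1, Theorem 3.1.1] -/
theorem count_le_envelope (d : ℕ) [NeZero d] (n : ℕ) :
    (count d n : ℝ) ≤ Real.exp (hwEnvelope (connectiveConstant d) n) * connectiveConstant d ^ n := by
  have hμ := connectiveConstant_pos d
  have h1 := count_le_sharp_mul_bridgeCount (d := d) n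
  have h2 := bridgeCount_le_pow (d := d) (n + 1)
  have h3 : (count d n : ℝ) ≤ (n + 1) * Real.exp (Real.pi * Real.sqrt (2 * (n + 1) / 3)) *
      connectiveConstant d ^ (n + 1) := h1.trans (mul_le_mul_of_nonneg_left h2 (by positivity))
  have e : Real.exp (hwEnvelope (connectiveConstant d) n) * connectiveConstant d ^ n =
      (n + 1) * Real.exp (Real.pi * Real.sqrt (2 * (n + 1) / 3)) * connectiveConstant d ^ (n + 1) := by
    rw [hwEnvelope, Real.exp_add, Real.exp_add, Real.exp_log (by positivity), Real.exp_log hμ, pow_succ]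
    ring
  rw [e]; exact h3

/-- The envelope is non-negative (`μ ≥ 1`). [folklore] -/
private theorem hwEnvelope_nonneg {μ : ℝ} (hμ : 1 ≤ μ) (n : ℕ) : 0 ≤ hwEnvelope μ n := by
  unfold hwEnvelope
  have h1 : 0 ≤ Real.log ((n : ℝ) + 1) := Real.log_nonneg (by have := Nat.cast_nonneg (α := ℝ) n; linarith)
  have h2 : 0 ≤ Real.log μ := Real.log_nonneg hμ
  positivity

/-- The envelope is monotone in `n` (`μ ≥ 1`). [folklore] -/
private theorem hwEnvelope_mono {μ : ℝ} {n m : ℕ} (hnm : n ≤ m) : hwEnvelope μ n ≤ hwEnvelope μ m := by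
  unfold hwEnvelope
  have hnm' : (n : ℝ) ≤ m := by exact_mod_cast hnm
  have h1 : Real.log ((n : ℝ) + 1) ≤ Real.log ((m : ℝ) + 1) :=
    Real.log_le_log (by positivity) (by linarith)
  have h2 : Real.sqrt (2 * ((n : ℝ) + 1) / 3) ≤ Real.sqrt (2 * ((m : ℝ) + 1) / 3) :=
    Real.sqrt_le_sqrt (by linarith)
  nlinarith [Real.pi_pos]

/-- `log(1 + x) ≥ x/3` on `[0, 2]`. [folklore] -/
private theorem log_one_add_ge {x : ℝ} (hx0 : 0 ≤ x) (hx2 : x ≤ 2) : x / 3 ≤ Real.log (1 + x) := by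
  have h := Real.one_sub_inv_le_log_of_pos (show 0 < 1 + x by linarith)
  have e : 1 - (1 + x)⁻¹ = x / (1 + x) := by field_simp; ring
  rw [e] at h
  have h2 : x / 3 ≤ x / (1 + x) := div_le_div_of_nonneg_left hx0 (by linarith) (by linarith)
  linarith

/-- `−log(1 − x) ≥ x` for `x < 1`. [folklore] -/
private theorem neg_log_one_sub_ge {x : ℝ} (hx : x < 1) : x ≤ -Real.log (1 - x) := by
  have h := Real.log_le_sub_one_of_pos (show 0 < 1 - x by linarith)
  linarith

/-- The algebra of the last step: from `(uN/(kB) − 1)·(u/(lμ²)) ≤ G` (`k,l > 0`) to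
`u² N ≤ k l B μ² G + k B u`. [folklore] -/
private theorem sq_mul_le_of {u N B μ G k l : ℝ} (hB : 0 < B) (hμ : 0 < μ) (hk : 0 < k) (hl : 0 < l)
    (h : (u * N / (k * B) - 1) * (u / (l * μ ^ 2)) ≤ G) :
    u ^ 2 * N ≤ k * l * B * μ ^ 2 * G + k * B * u := by
  have hden : 0 < k * B * (l * μ ^ 2) := by positivity
  have e : (u * N / (k * B) - 1) * (u / (l * μ ^ 2)) = (u ^ 2 * N - k * B * u) / (k * B * (l * μ ^ 2)) := by
    field_simp
  rw [e, div_le_iff₀ hden] at h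
  nlinarith

/-! ### The headline on `ℤ²` -/

/-- **Explicit Kesten ratio rate on `ℤ²`** (every `N ≥ 1`): under the explicit pattern-density input
`PatternDensityPoly 0 a C`,
`|c_{N+2}/c_N − μ²| ≤ μ · √(12 (D + 16) (G(2N) + 1) / N)` with `D = kestenD 0 a C = 4/a³ + 2/a² + 442 C`
and `G = hwEnvelope μ` — a rate `K(a,C) N^{-1/4}` with `K` in closed form (printed: Kesten 1963, rate `N^{-1/3}`,
constant inexplicit; Madras–Slade (7.5.1), p. 255).  Statement typed by the lane's ideation seat (a-idea-1,
`Sketch_G4_X24_KestenRate.lean`), taken verbatim.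
[cite: MadrasSlade1993, §7.5, eq. (7.5.1) and Lemma 7.3.1 / Theorem 7.3.2 (quantitative form, this file)] -/
theorem ratioRate_Z2_explicit {a C : ℝ} (ha : 0 < a) (hPT : PatternDensityPoly 0 a C)
    {N : ℕ} (hN : 1 ≤ N) :
    |(count 2 (N + 2) : ℝ) / count 2 N - connectiveConstant 2 ^ 2| ≤
      connectiveConstant 2 *
        Real.sqrt (12 * (kestenD 0 a C + 16) *
          (hwEnvelope (connectiveConstant 2) (2 * N) + 1) / N) := by
  -- the data
  set μ := connectiveConstant 2 with hμdef
  set c : ℕ → ℝ := fun n => (count 2 n : ℝ) with hcdef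
  set D := kestenD 0 a C with hDdef
  set B := D + 16 with hBdef
  set G : ℕ → ℝ := hwEnvelope μ with hGdef
  have hc : ∀ n, 0 < c n := fun n => by simp only [hcdef]; exact_mod_cast one_le_count 2 n
  have hμ2 : 2 ≤ μ := by
    have := BDGS2012_count_bounds_holds.le_connectiveConstant 2; simpa using this
  have hμ3 : μ ≤ 3 := by
    have := connectiveConstant_le 2 (by norm_num); norm_num at this; exact this
  have hμ : 0 < μ := by linarith
  have hμ1 : 1 ≤ μ := by linarith
  have hC0 : 0 ≤ C := by
    have h1 := hPT 1 le_rfl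
    rw [Nat.cast_one, one_pow, div_one] at h1
    exact nonneg_of_mul_nonneg_left ((Nat.cast_nonneg _).trans h1) (by exact_mod_cast one_le_count 2 1)
  have hD0 : 0 ≤ D := by rw [hDdef]; unfold kestenD; positivity
  have hB0 : 0 < B := by rw [hBdef]; linarith
  have hB16 : 16 ≤ B := by rw [hBdef]; linarith
  have hN0 : (0 : ℝ) < N := by exact_mod_cast hN
  -- (7.3.3) with `B`
  have hK : ∀ n : ℕ, 1 ≤ n → c (n + 2) / c n - B / n ≤ c (n + 4) / c (n + 2) := by
    intro n hn
    have h := kesten733_explicit 0 ha hPT hn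
    have hn0 : (0 : ℝ) < n := by exact_mod_cast hn
    have : D / (n : ℝ) ≤ B / n := div_le_div_of_nonneg_right (by linarith) hn0.le
    simp only [hcdef]
    rw [← hDdef] at h
    linarith
  have hlo : ∀ n, μ ^ n ≤ c n := fun n => pow_connectiveConstant_le_count 2 n
  have hhi : ∀ n, c n ≤ Real.exp (G n) * μ ^ n := fun n => count_le_envelope 2 n
  have hG0 : 0 ≤ G (2 * N) := hwEnvelope_nonneg hμ1 _
  -- `φ_N ≤ 12`
  set φ := c (N + 2) / c N with hφdef
  have hφ12 : φ ≤ 12 := by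
    rw [hφdef, div_le_iff₀ (hc N)]
    have h1 : (count 2 (N + 2) : ℝ) ≤ count 2 N * count 2 2 := by exact_mod_cast count_add_le 2 N 2
    have h2 : (count 2 2 : ℝ) ≤ 12 := by
      have := count_succ_le 2 1; norm_num at this; exact_mod_cast this
    simp only [hcdef]
    nlinarith [(Nat.cast_nonneg (count 2 N) : (0 : ℝ) ≤ count 2 N)]
  have hφ1 : 1 ≤ φ := by
    rw [hφdef, le_div_iff₀ (hc N), one_mul]; simp only [hcdef]
    exact_mod_cast count_le_count_add_two 2 N
  -- the target quantity
  set R := μ * Real.sqrt (12 * B * (G (2 * N) + 1) / N) with hRdef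
  have hR_of_sq : ∀ u : ℝ, 0 ≤ u → u ^ 2 * N ≤ 12 * B * μ ^ 2 * (G (2 * N) + 1) → u ≤ R := by
    intro u hu0 h
    rw [hRdef]
    have e : μ * Real.sqrt (12 * B * (G (2 * N) + 1) / N) = Real.sqrt (μ ^ 2 * (12 * B * (G (2 * N) + 1) / N)) := by
      rw [Real.sqrt_mul' _ (by positivity), Real.sqrt_sq hμ.le]
    rw [e, Real.le_sqrt hu0 (by positivity), ← mul_div_assoc, le_div_iff₀ hN0]
    linarith [h]
  show |φ - μ ^ 2| ≤ R
  rcases lt_trichotomy φ (μ ^ 2) with hlt | heq | hgt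
  · -- lower deviation
    set u := μ ^ 2 - φ with hudef
    have hu : 0 < u := by rw [hudef]; linarith
    have hμ9 : μ ^ 2 ≤ 9 := by nlinarith
    have hu8 : u ≤ 8 := by rw [hudef]; linarith
    rw [abs_sub_comm, abs_of_pos (by linarith : 0 < μ ^ 2 - φ)]
    set M := ⌊u * N / (4 * B)⌋₊ with hMdef
    have hMle : (M : ℝ) ≤ u * N / (4 * B) := Nat.floor_le (by positivity)
    have hMge : u * N / (4 * B) - 1 ≤ M := by
      have := Nat.lt_floor_add_one (u * N / (4 * B)); rw [← hMdef] at this; linarith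
    have h4M : 4 * (M : ℝ) ≤ N := by
      have : u * N / (4 * B) ≤ N / 4 := by
        rw [div_le_div_iff₀ (by positivity) (by norm_num)]; nlinarith
      linarith
    have h4Mn : 4 * M ≤ N := by exact_mod_cast h4M
    set N' := N - 2 * M with hN'def
    have hN'1 : 1 ≤ N' := by omega
    have h2M : 2 * M ≤ N' := by omega
    have hNN : N' + 2 * M = N := by omega
    have hdev : c (N' + 2 * M + 2) / c (N' + 2 * M) ≤ μ ^ 2 - u := by rw [hNN, ← hφdef, hudef]; linarith
    have hM4 : 4 * (M : ℝ) * B ≤ u * ((N' : ℝ) + 2 * M) := by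
      have e : ((N' : ℝ) + 2 * M) = N := by exact_mod_cast hNN
      rw [e]
      have := mul_le_mul_of_nonneg_right hMle (show (0:ℝ) ≤ 4 * B by positivity)
      rw [div_mul_cancel₀ _ (by positivity)] at this
      linarith
    have hld := lower_dev hc hμ hB0.le hK hlo hhi hN'1 h2M hu hdev hM4
    -- `M x ≤ G(N') ≤ G(2N)` with `x = u/(2μ²)`
    have hx1 : u / (2 * μ ^ 2) < 1 := by rw [div_lt_one (by positivity)]; nlinarith
    have hx0 : 0 ≤ u / (2 * μ ^ 2) := by positivity
    have hlog := neg_log_one_sub_ge hx1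
    have hGmono : G N' ≤ G (2 * N) := hwEnvelope_mono (by omega)
    have h1 : (M : ℝ) * (u / (2 * μ ^ 2)) ≤ G (2 * N) := by
      have := mul_le_mul_of_nonneg_left hlog (Nat.cast_nonneg M)
      linarith
    have h2 : (u * N / (4 * B) - 1) * (u / (2 * μ ^ 2)) ≤ G (2 * N) := by
      rcases le_or_gt 0 (u * N / (4 * B) - 1) with hpos | hneg
      · exact (mul_le_mul_of_nonneg_right hMge hx0).trans h1
      · exact (mul_nonpos_of_nonpos_of_nonneg hneg.le hx0).trans hG0
    have h3 := sq_mul_le_of hB0 hμ (by norm_num : (0:ℝ) < 4) (by norm_num : (0:ℝ) < 2) h2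
    refine hR_of_sq u hu.le ?_
    have hμsq : 4 ≤ μ ^ 2 := by
      have := mul_le_mul hμ2 hμ2 (by norm_num) (by linarith); rw [pow_two]; linarith
    have h4 : B * u ≤ B * (3 * μ ^ 2) := mul_le_mul_of_nonneg_left (by linarith) hB0.le
    have h5 : 0 ≤ B * μ ^ 2 * G (2 * N) := by positivity
    have e3 : (4 : ℝ) * 2 * B * μ ^ 2 * G (2 * N) + 4 * B * u = 8 * (B * μ ^ 2 * G (2 * N)) + 4 * (B * u) := by ring
    have e4 : (12 : ℝ) * B * μ ^ 2 * (G (2 * N) + 1) = 12 * (B * μ ^ 2 * G (2 * N)) + 4 * (B * (3 * μ ^ 2)) := by ring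
    rw [e3] at h3; rw [e4]
    linarith
  · rw [heq, sub_self, abs_zero]; positivity
  · -- upper deviation
    set u := φ - μ ^ 2 with hudef
    have hu : 0 < u := by rw [hudef]; linarith
    have hμ0' : 0 ≤ μ ^ 2 := by positivity
    have hu12 : u ≤ 12 := by rw [hudef]; linarith
    rw [abs_of_pos (by linarith : 0 < φ - μ ^ 2)]
    set M := ⌊u * N / (2 * B)⌋₊ with hMdef
    have hMle : (M : ℝ) ≤ u * N / (2 * B) := Nat.floor_le (by positivity)
    have hMge : u * N / (2 * B) - 1 ≤ M := by
      have := Nat.lt_floor_add_one (u * N / (2 * B)); rw [← hMdef] at this; linarith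
    have h2M : 2 * (M : ℝ) ≤ N := by
      have : u * N / (2 * B) ≤ N / 2 := by
        rw [div_le_div_iff₀ (by positivity) (by norm_num)]; nlinarith
      linarith
    have h2Mn : 2 * M ≤ N := by exact_mod_cast h2M
    have hdev : μ ^ 2 + u ≤ c (N + 2) / c N := by rw [← hφdef, hudef]; linarith
    have hMB : (M : ℝ) * B ≤ u * N / 2 := by
      have h1 := mul_le_mul_of_nonneg_right hMle hB0.le
      have e : u * N / (2 * B) * B = u * N / 2 := by field_simp
      rw [e] at h1; exact h1
    have hud := upper_dev hc hμ hB0.le hK hlo hhi hN hu hdev hMB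
    have hx0 : 0 ≤ u / (2 * μ ^ 2) := by positivity
    have hx2 : u / (2 * μ ^ 2) ≤ 2 := by rw [div_le_iff₀ (by positivity)]; nlinarith
    have hlog := log_one_add_ge hx0 hx2
    have hGmono : G (N + 2 * M) ≤ G (2 * N) := hwEnvelope_mono (by omega)
    have h1 : (M : ℝ) * (u / (2 * μ ^ 2) / 3) ≤ G (2 * N) := by
      have := mul_le_mul_of_nonneg_left hlog (Nat.cast_nonneg M)
      linarith
    have h2 : (u * N / (2 * B) - 1) * (u / (6 * μ ^ 2)) ≤ G (2 * N) := by
      have e : u / (6 * μ ^ 2) = u / (2 * μ ^ 2) / 3 := by field_simp; ring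
      rw [e]
      rcases le_or_gt 0 (u * N / (2 * B) - 1) with hpos | hneg
      · exact (mul_le_mul_of_nonneg_right hMge (by positivity)).trans h1
      · exact (mul_nonpos_of_nonpos_of_nonneg hneg.le (by positivity)).trans hG0
    have h3 := sq_mul_le_of hB0 hμ (by norm_num : (0:ℝ) < 2) (by norm_num : (0:ℝ) < 6) h2
    refine hR_of_sq u hu.le ?_
    have hμsq : 4 ≤ μ ^ 2 := by
      have := mul_le_mul hμ2 hμ2 (by norm_num) (by linarith); rw [pow_two]; linarith
    have h4 : B * u ≤ B * (6 * μ ^ 2) := mul_le_mul_of_nonneg_left (by linarith) hB0.le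
    have h5 : 0 ≤ B * μ ^ 2 * G (2 * N) := by positivity
    have e3 : (2 : ℝ) * 6 * B * μ ^ 2 * G (2 * N) + 2 * B * u = 12 * (B * μ ^ 2 * G (2 * N)) + 2 * (B * u) := by ring
    have e4 : (12 : ℝ) * B * μ ^ 2 * (G (2 * N) + 1) = 12 * (B * μ ^ 2 * G (2 * N)) + 2 * (B * (6 * μ ^ 2)) := by ring
    rw [e3] at h3; rw [e4]
    linarith

/-! ### v2: the upper deviation at Kesten's printed exponent `1/3`

Replacing the lower envelope `μ^N ≤ c_N` by SUBMULTIPLICATIVITY `c_{N+2M} ≤ c_N c_{2M}` puts the sub-exponential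
slack at length `2M ≈ uN/B` instead of `N + 2M`; balancing gives `u³ ≲ B/N`. -/

/-- **Upper deviation via submultiplicativity** (quantitative Lemma 7.3.1, sharp side): if `φ_N ≥ μ² + u` and
`M·B ≤ uN/2` then `(μ² + u/2)^M c_N ≤ c_{N+2M} ≤ c_N c_{2M} ≤ c_N e^{G(2M)} μ^{2M}`, i.e.
`M log(1 + u/(2μ²)) ≤ G(2M)`. [cite: MadrasSlade1993, Lemma 7.3.1 (proof, quantitative form)] -/
theorem upper_dev_submult {c : ℕ → ℝ} {μ B u : ℝ} {G : ℕ → ℝ} (hc : ∀ n, 0 < c n) (hμ : 0 < μ)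
    (hB : 0 ≤ B) (hK : ∀ n : ℕ, 1 ≤ n → c (n + 2) / c n - B / n ≤ c (n + 4) / c (n + 2))
    (hsub : ∀ n m : ℕ, c (n + m) ≤ c n * c m) (hhi : ∀ n, c n ≤ Real.exp (G n) * μ ^ n)
    {N M : ℕ} (hN : 1 ≤ N) (hu : 0 < u) (hdev : μ ^ 2 + u ≤ c (N + 2) / c N)
    (hM : (M : ℝ) * B ≤ u * N / 2) :
    (M : ℝ) * Real.log (1 + u / (2 * μ ^ 2)) ≤ G (2 * M) := by
  have hN0 : (0 : ℝ) < N := by exact_mod_cast hN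
  set q : ℝ := μ ^ 2 + u / 2 with hq
  have hq0 : 0 ≤ q := by positivity
  have hK' : ∀ n : ℕ, 1 ≤ n → (fun n => c (n + 2) / c n) n - B / n ≤ (fun n => c (n + 2) / c n) (n + 2) := by
    intro n hn; simpa [add_assoc] using hK n hn
  have hiter := kesten_iter_forward (φ := fun n => c (n + 2) / c n) (N₁ := 1) hB hK' hN hN
  have hstep : ∀ k < M, q ≤ c (N + 2 * k + 2) / c (N + 2 * k) := by
    intro k hk
    have h1 := hiter k
    have h2 : (k : ℝ) * B / N ≤ u / 2 := by
      rw [div_le_iff₀ hN0]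
      have : (k : ℝ) * B ≤ M * B := mul_le_mul_of_nonneg_right (by exact_mod_cast hk.le) hB
      linarith
    have e : c (N + 2 * k + 2) / c (N + 2 * k) = (fun n => c (n + 2) / c n) (N + 2 * k) := rfl
    rw [e]
    linarith
  have hprod := kesten_prod_ge hc (n := N) (M := M) hq0 hstep
  -- `q^M c_N ≤ c_{N+2M} ≤ c_N c_{2M} ≤ c_N e^{G(2M)} μ^{2M}`
  have h1 : q ^ M * c N ≤ Real.exp (G (2 * M)) * μ ^ (2 * M) * c N :=
    calc q ^ M * c N ≤ c (N + 2 * M) := hprod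
      _ ≤ c N * c (2 * M) := hsub N (2 * M)
      _ ≤ c N * (Real.exp (G (2 * M)) * μ ^ (2 * M)) := mul_le_mul_of_nonneg_left (hhi _) (hc N).le
      _ = _ := by ring
  have h2 : (q / μ ^ 2) ^ M ≤ Real.exp (G (2 * M)) := by
    rw [div_pow, div_le_iff₀ (by positivity), ← pow_mul]
    exact le_of_mul_le_mul_right h1 (hc N)
  have hr : q / μ ^ 2 = 1 + u / (2 * μ ^ 2) := by rw [hq]; field_simp
  have hr0 : 0 < q / μ ^ 2 := by rw [hr]; positivity
  have h3 := Real.log_le_log (pow_pos hr0 M) h2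
  rw [Real.log_exp, Real.log_pow, hr] at h3
  exact h3

/-- `log(1 + y) ≤ √y` for `y ≥ 0` (from `1 + s² ≤ 1 + s + s²/2 + s³/6 ≤ e^s`). [folklore] -/
private theorem log_one_add_le_sqrt {y : ℝ} (hy : 0 ≤ y) : Real.log (1 + y) ≤ Real.sqrt y := by
  set s := Real.sqrt y with hs
  have hs0 : 0 ≤ s := Real.sqrt_nonneg y
  have hy' : y = s ^ 2 := by rw [hs, Real.sq_sqrt hy]
  have h := Real.sum_le_exp_of_nonneg hs0 4
  simp only [Finset.sum_range_succ, Finset.sum_range_zero, Nat.factorial, pow_zero, pow_one,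
    Nat.cast_ofNat, zero_add, Nat.succ_eq_add_one, Nat.reduceAdd, Nat.reduceMul,
    Nat.cast_succ] at h
  have h1 : 1 + y ≤ Real.exp s := by
    rw [hy']; nlinarith [sq_nonneg (s - 3 / 2), hs0, sq_nonneg s]
  calc Real.log (1 + y) ≤ Real.log (Real.exp s) := Real.log_le_log (by linarith) h1
    _ = s := Real.log_exp s

/-- `log(1 + x) ≥ x/2` on `[0, 1]`. [folklore] -/
private theorem log_one_add_ge_half {x : ℝ} (hx0 : 0 ≤ x) (hx1 : x ≤ 1) : x / 2 ≤ Real.log (1 + x) := by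
  have h := Real.add_one_le_exp (-(Real.log (1 + x)))
  rw [Real.exp_neg, Real.exp_log (by linarith)] at h
  -- `1 - log(1+x) ≤ 1/(1+x)` ⇒ `log(1+x) ≥ x/(1+x) ≥ x/2`
  have h1 : x / (1 + x) ≤ Real.log (1 + x) := by
    rw [div_le_iff₀ (by linarith)]
    have : (1 - Real.log (1 + x)) * (1 + x) ≤ 1 := by
      calc (1 - Real.log (1 + x)) * (1 + x) = (-Real.log (1 + x) + 1) * (1 + x) := by ring
        _ ≤ (1 + x)⁻¹ * (1 + x) := mul_le_mul_of_nonneg_right h (by linarith)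
        _ = 1 := inv_mul_cancel₀ (by linarith)
    nlinarith
  have h2 : x / 2 ≤ x / (1 + x) := div_le_div_of_nonneg_left hx0 (by linarith) (by linarith)
  linarith

/-- `log 3 ≤ 6/5` (from `e^{6/5} ≥ 1 + 6/5 + (6/5)²/2 + (6/5)³/6 ≥ 3`). [folklore] -/
private theorem log_three_le : Real.log 3 ≤ 6 / 5 := by
  have h := Real.sum_le_exp_of_nonneg (show (0 : ℝ) ≤ 6 / 5 by norm_num) 4
  simp only [Finset.sum_range_succ, Finset.sum_range_zero, Nat.factorial, pow_zero, pow_one,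
    Nat.cast_ofNat, zero_add, Nat.succ_eq_add_one, Nat.reduceAdd, Nat.reduceMul,
    Nat.cast_succ] at h
  have h3 : (3 : ℝ) ≤ Real.exp (6 / 5) := by nlinarith [h]
  calc Real.log 3 ≤ Real.log (Real.exp (6 / 5)) := Real.log_le_log (by norm_num) h3
    _ = 6 / 5 := Real.log_exp _
set_option maxHeartbeats 400000 in
/-- **Upper rate on `ℤ²` at exponent `1/3`** (`rpow`-free form, every `N ≥ 1`): with
`B = kestenD 0 a C + 16`, if `4B ≤ uN` and `81³ B ≤ u³ N` then `c_{N+2}/c_N ≤ μ² + u`; equivalently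
`c_{N+2}/c_N − μ² ≤ max (4B/N, 81 (B/N)^{1/3})` — Kesten's printed exponent, with an explicit constant in terms
of the pattern-density input. Proof: otherwise `upper_dev_submult` with `M = ⌊uN/(2B)⌋`, `y = uN/B ≥ 4`,
`x = u/(2μ²) ≤ 1`, `log(1+x) ≥ x/2`, `M ≥ y/4`, `G(2M) ≤ log(1+y) + π√(2(y+1)/3) + log μ ≤ (1 + π + 3/5)√y`
gives `u³N ≤ 256 (8/5 + π)² μ⁴ B < 81³ B`. [cite: MadrasSlade1993, §7.5, eq. (7.5.1) (Kesten 1963: the upper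
side at the printed exponent `1/3`; quantitative form, this file)] -/
theorem upperRate_Z2_cubeRoot {a C : ℝ} (ha : 0 < a) (hPT : PatternDensityPoly 0 a C)
    {N : ℕ} (hN : 1 ≤ N) {u : ℝ} (hu : 0 < u)
    (hu1 : 4 * (kestenD 0 a C + 16) ≤ u * N)
    (hu2 : (81 : ℝ) ^ 3 * (kestenD 0 a C + 16) ≤ u ^ 3 * N) :
    (count 2 (N + 2) : ℝ) / count 2 N ≤ connectiveConstant 2 ^ 2 + u := by
  by_contra hcon
  rw [not_le] at hcon
  -- the data
  set μ := connectiveConstant 2 with hμdef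
  set c : ℕ → ℝ := fun n => (count 2 n : ℝ) with hcdef
  set D := kestenD 0 a C with hDdef
  set B := D + 16 with hBdef
  set G : ℕ → ℝ := hwEnvelope μ with hGdef
  have hc : ∀ n, 0 < c n := fun n => by simp only [hcdef]; exact_mod_cast one_le_count 2 n
  have hμ2 : 2 ≤ μ := by
    have := BDGS2012_count_bounds_holds.le_connectiveConstant 2; simpa using this
  have hμ3 : μ ≤ 3 := by
    have := connectiveConstant_le 2 (by norm_num); norm_num at this; exact this
  have hμ : 0 < μ := by linarith
  have hC0 : 0 ≤ C := by
    have h1 := hPT 1 le_rfl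
    rw [Nat.cast_one, one_pow, div_one] at h1
    exact nonneg_of_mul_nonneg_left ((Nat.cast_nonneg _).trans h1) (by exact_mod_cast one_le_count 2 1)
  have hD0 : 0 ≤ D := by rw [hDdef]; unfold kestenD; positivity
  have hB0 : 0 < B := by rw [hBdef]; linarith
  have hN0 : (0 : ℝ) < N := by exact_mod_cast hN
  -- (7.3.3) with `B`
  have hK : ∀ n : ℕ, 1 ≤ n → c (n + 2) / c n - B / n ≤ c (n + 4) / c (n + 2) := by
    intro n hn
    have h := kesten733_explicit 0 ha hPT hn
    have hn0 : (0 : ℝ) < n := by exact_mod_cast hn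
    have : D / (n : ℝ) ≤ B / n := div_le_div_of_nonneg_right (by linarith) hn0.le
    simp only [hcdef]
    rw [← hDdef] at h
    linarith
  have hsub : ∀ n m : ℕ, c (n + m) ≤ c n * c m := fun n m => by
    simp only [hcdef]; exact_mod_cast count_add_le 2 n m
  have hhi : ∀ n, c n ≤ Real.exp (G n) * μ ^ n := fun n => count_le_envelope 2 n
  -- `φ_N ≤ 12`, so `u < 8` and `x = u/(2μ²) ≤ 1`
  set φ := c (N + 2) / c N with hφdef
  have hφ12 : φ ≤ 12 := by
    rw [hφdef, div_le_iff₀ (hc N)]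
    have h1 : (count 2 (N + 2) : ℝ) ≤ count 2 N * count 2 2 := by exact_mod_cast count_add_le 2 N 2
    have h2 : (count 2 2 : ℝ) ≤ 12 := by
      have := count_succ_le 2 1; norm_num at this; exact_mod_cast this
    simp only [hcdef]
    nlinarith [(Nat.cast_nonneg (count 2 N) : (0 : ℝ) ≤ count 2 N)]
  have hdev : μ ^ 2 + u ≤ c (N + 2) / c N := by rw [← hφdef]; exact hcon.le
  have hμsq : 4 ≤ μ ^ 2 := by nlinarith
  have hμ9 : μ ^ 2 ≤ 9 := by nlinarith
  have hu8 : u ≤ 8 := by linarith [hcon]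
  set x := u / (2 * μ ^ 2) with hxdef
  have hx0 : 0 ≤ x := by positivity
  have hx1 : x ≤ 1 := by rw [hxdef, div_le_one (by positivity)]; linarith
  -- `M = ⌊uN/(2B)⌋`, `y = uN/B ≥ 4`
  set y := u * N / B with hydef
  have hy4 : 4 ≤ y := by rw [hydef, le_div_iff₀ hB0]; linarith
  have hy0 : 0 < y := by linarith
  set M := ⌊u * N / (2 * B)⌋₊ with hMdef
  have hMle : (M : ℝ) ≤ u * N / (2 * B) := Nat.floor_le (by positivity)
  have hMge : u * N / (2 * B) - 1 ≤ M := by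
    have := Nat.lt_floor_add_one (u * N / (2 * B)); rw [← hMdef] at this; linarith
  have hy2 : u * N / (2 * B) = y / 2 := by rw [hydef]; field_simp
  rw [hy2] at hMle hMge
  have hMy : y / 4 ≤ M := by linarith
  have h2My : 2 * (M : ℝ) ≤ y := by linarith
  have hM : (M : ℝ) * B ≤ u * N / 2 := by
    have : (M : ℝ) * B ≤ y / 2 * B := mul_le_mul_of_nonneg_right hMle hB0.le
    rw [hydef] at this
    calc (M : ℝ) * B ≤ u * N / B / 2 * B := by linarith
      _ = u * N / 2 := by field_simp
  -- the sharp upper deviation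
  have hA := upper_dev_submult hc hμ hB0.le hK hsub hhi hN hu hdev hM
  rw [← hxdef] at hA
  -- lower bound of the left side: `(y/4)(x/2) ≤ M log(1+x)`
  have hlog : x / 2 ≤ Real.log (1 + x) := log_one_add_ge_half hx0 hx1
  have hL : y / 4 * (x / 2) ≤ (M : ℝ) * Real.log (1 + x) :=
    mul_le_mul hMy hlog (by positivity) (Nat.cast_nonneg M)
  -- upper bound of the right side: `G(2M) ≤ (8/5 + π) √y`
  have hsy2 : 2 ≤ Real.sqrt y := by
    rw [show (2 : ℝ) = Real.sqrt 4 by rw [show (4 : ℝ) = 2 ^ 2 by norm_num, Real.sqrt_sq (by norm_num)]]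
    exact Real.sqrt_le_sqrt hy4
  have hsy0 : 0 < Real.sqrt y := by linarith
  have hG : G (2 * M) ≤ (8 / 5 + Real.pi) * Real.sqrt y := by
    show hwEnvelope μ (2 * M) ≤ _
    unfold hwEnvelope
    have e2M : ((2 * M : ℕ) : ℝ) = 2 * (M : ℝ) := by push_cast; ring
    rw [e2M]
    have h1 : Real.log (2 * (M : ℝ) + 1) ≤ Real.sqrt y := by
      calc Real.log (2 * (M : ℝ) + 1) ≤ Real.log (1 + y) :=
            Real.log_le_log (by positivity) (by linarith)
        _ ≤ Real.sqrt y := log_one_add_le_sqrt hy0.le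
    have h2 : Real.sqrt (2 * (2 * (M : ℝ) + 1) / 3) ≤ Real.sqrt y :=
      Real.sqrt_le_sqrt (by linarith)
    have h3 : Real.log μ ≤ 3 / 5 * Real.sqrt y :=
      calc Real.log μ ≤ Real.log 3 := Real.log_le_log hμ hμ3
        _ ≤ 6 / 5 := log_three_le
        _ ≤ 3 / 5 * Real.sqrt y := by linarith
    have h2' : Real.pi * Real.sqrt (2 * (2 * (M : ℝ) + 1) / 3) ≤ Real.pi * Real.sqrt y :=
      mul_le_mul_of_nonneg_left h2 Real.pi_pos.le
    linarith
  -- combine: `y x / 8 ≤ (8/5 + π) √y`, i.e. `u √y ≤ 16 (8/5 + π) μ²`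
  have hcomb : y * x / 8 ≤ (8 / 5 + Real.pi) * Real.sqrt y := by linarith
  have hpi : Real.pi < 3.15 := Real.pi_lt_d2
  set k := (8 / 5 + Real.pi) with hkdef
  have hk0 : 0 < k := by rw [hkdef]; linarith [Real.pi_pos]
  have hk1 : k ≤ 19 / 4 := by rw [hkdef]; linarith
  -- `y = √y²`
  have hyy : y = Real.sqrt y * Real.sqrt y := (Real.mul_self_sqrt hy0.le).symm
  have hux : y * x = u * y / (2 * μ ^ 2) := by rw [hxdef]; ring
  -- `u √y ≤ 16 k μ²`
  have h5 : u * Real.sqrt y ≤ 16 * k * μ ^ 2 := by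
    have h6 : u * y ≤ 16 * k * μ ^ 2 * Real.sqrt y := by
      have : u * y / (2 * μ ^ 2) ≤ 8 * (k * Real.sqrt y) := by rw [← hux]; linarith
      rw [div_le_iff₀ (by positivity)] at this; linarith
    have h7 : (u * Real.sqrt y) * Real.sqrt y ≤ (16 * k * μ ^ 2) * Real.sqrt y := by
      have e : (u * Real.sqrt y) * Real.sqrt y = u * y := by rw [mul_assoc, ← hyy]
      rw [e]; exact h6
    exact le_of_mul_le_mul_right h7 hsy0
  -- square and multiply out: `u² y ≤ 256 k² μ⁴`, `u³ N = u² y B ≤ 256 k² μ⁴ B < 81³ B`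
  have hu0 : 0 ≤ u * Real.sqrt y := by positivity
  have h8 : u ^ 2 * y ≤ (16 * k * μ ^ 2) ^ 2 := by
    have := mul_le_mul h5 h5 hu0 (by positivity)
    have e : (u * Real.sqrt y) * (u * Real.sqrt y) = u ^ 2 * (Real.sqrt y * Real.sqrt y) := by ring
    rw [← hyy] at e
    rw [← e, pow_two (16 * k * μ ^ 2)]; exact this
  have h9 : (16 * k * μ ^ 2) ^ 2 ≤ 256 * (19 / 4) ^ 2 * 81 := by
    have hk2 : k ^ 2 ≤ (19 / 4) ^ 2 := pow_le_pow_left₀ hk0.le hk1 2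
    have hm4 : (μ ^ 2) ^ 2 ≤ 81 := by nlinarith
    calc (16 * k * μ ^ 2) ^ 2 = 256 * k ^ 2 * (μ ^ 2) ^ 2 := by ring
      _ ≤ 256 * (19 / 4) ^ 2 * (μ ^ 2) ^ 2 :=
          mul_le_mul_of_nonneg_right (mul_le_mul_of_nonneg_left hk2 (by norm_num)) (by positivity)
      _ ≤ 256 * (19 / 4) ^ 2 * 81 := mul_le_mul_of_nonneg_left hm4 (by norm_num)
  have h10 : u ^ 3 * N = u ^ 2 * y * B := by rw [hydef]; field_simp
  have h11 : u ^ 3 * N < (81 : ℝ) ^ 3 * B := by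
    rw [h10]
    have : u ^ 2 * y * B ≤ 256 * (19 / 4) ^ 2 * 81 * B :=
      mul_le_mul_of_nonneg_right (h8.trans h9) hB0.le
    have h12 : (256 : ℝ) * (19 / 4) ^ 2 * 81 * B < 81 ^ 3 * B :=
      mul_lt_mul_of_pos_right (by norm_num) hB0
    linarith
  linarith

end KestenRate

end Literature.Probability.RandomPlanarGeometry.SAW.Zd
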